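import Mathlib
import Summits.Ventures.HSemireg.LineLawCommonRoot
import Summits.Ventures.HSemireg.LineLawGeneralCapture

/-!
# LINE LAW — THEOREM A′ «⇐» ASSEMBLED: the simple law implies every weight is captured at ONE common root, for
# `m ≡ 1 (mod 4)`, `m < 0` squarefree, one class per genus (ENGINE-W code B, #B23)

LINE-LAW-THEOREMS-B.md §3, THEOREM A′ (sufficiency): under hypothesis (H) = one class per genus for discriminant `4m`
(`h(4m) = 2^{μ−1}`), a weight line passing the SIMPLE LAW at `T` — every quotient `n_j = T∕c_j` is the norm of a primitive
element of `ℤ[√m]` (`n_j > 0`) AND the even `n_j` obey PROPOSITION 2's 2-ADIC RULE (all of ONE 2-adic valuation `e`) — is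
reached at `T`.  By THEOREM CF⁶ (by value, as everywhere in this index) «reached» means: primitive `z_j` with `N z_j = n_j` and ONE
integer `A` with `z_j ∣ A − √m` for all `j`.  This file proves exactly that conclusion:
* `lineLaw_sufficiency_one_mod_four` — `m < 0` squarefree, `m ≡ 1 (mod 4)`, `h(4m) = 2^{μ−1}`; a finite list of quotients `n`, each
  `n = x² − m y² > 0` with `x, y` coprime; all even `n` exactly divisible by the same `2^e`.  THEN some integer `A` admits, for
  every listed `n`, a primitive `z ∈ ℤ√m` with `N z = n` and `z ∣ A − √m`.
Assembly: STEP 1 (one `A` for all weights) = `LineLawCommonRoot.exists_common_root` (k = 324: `m` is a square modulo every `n`,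
hence modulo their lcm) + the 2-adic adjustment of §3 STEP 1 made explicit (`adjust_not_dvd`: for `m ≡ 1 (mod 8)`, `e ≥ 3`, replacing
`A` by `A + 2^{e−1}·M′` with `M′` the odd part of `∏ n` keeps every divisibility and makes `v₂(A² − m) = e` EXACTLY, so every even
weight's cofactor `k = (A² − m)∕n` is odd; for `m ≡ 5 (mod 8)` an odd `A` has `v₂(A² − m) = 2 = e` automatically —
`norm_two_adic`: an even primitive norm has `x, y` odd and `n ≡ 1 − m (mod 8)`); then STEPS 2–4 = #B22
`LineLawGeneralCapture.capture_one_mod_four_of_parity` weight by weight.  So THEOREM A′ «⇐» is kernel modulo THEOREM CF⁶ by value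
(the reading of «reached»), exactly like THEOREM A (`LineLawRamifiedCapture.lineLaw_sufficiency`, k = 331).
Honest framing: integer ∕ `ℤ√m` arithmetic only; Mukai vectors and lattices elsewhere, not objects; nothing here says that HC,
HC_CM or HC_AV holds.
-/

namespace Summit.Ventures.HSemireg.LineLawOneModFourSufficiency

open Zsqrtd
open Literature.NumberTheory.QuadraticFields (BinaryQuadraticForm.classNumber)
open Literature.NumberTheory.QuadraticFields.BinaryQuadraticForm (assignedCharCount)
open Summit.Ventures.HSemireg.LineLawCommonRoot (exists_common_root)
open Summit.Ventures.HSemireg.LineLawPrincipalGenus (exists_root_of_primitive_rep root_of_congr)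
open Summit.Ventures.HSemireg.LineLawGeneralCapture (capture_one_mod_four_of_parity)

/-! ## 2-adic facts -/

/-- `8 ∣ x² − 1` for odd `x`. -/
theorem eight_dvd_sq_sub_one {x : ℤ} (hx : Odd x) : (8 : ℤ) ∣ x ^ 2 - 1 := by
  obtain ⟨t, rfl⟩ := hx
  obtain ⟨u, hu⟩ := Int.even_mul_succ_self t
  exact ⟨u, by linear_combination 4 * hu⟩

/-- **An even primitive norm for odd `m`: both coordinates are odd and `n ≡ 1 − m (mod 8)`.** -/
theorem norm_two_adic {m n x y : ℤ} (hm : Odd m) (hrep : x ^ 2 - m * y ^ 2 = n) (hxy : IsCoprime x y) (hn : 2 ∣ n) :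
    Odd x ∧ Odd y ∧ (8 : ℤ) ∣ n - (1 - m) := by
  have hm2 : ¬ (2 : ℤ) ∣ m := by
    rw [← even_iff_two_dvd]; exact Int.not_even_iff_odd.2 hm
  have h2u : ¬ IsUnit (2 : ℤ) := by
    rw [Int.isUnit_iff]; omega
  have hx : Odd x := by
    rw [← Int.not_even_iff_odd, even_iff_two_dvd]
    intro h2x
    have h1 : (2 : ℤ) ∣ m * y ^ 2 := by
      have e : m * y ^ 2 = x ^ 2 - n := by linear_combination -hrep
      rw [e]; exact dvd_sub (dvd_pow h2x two_ne_zero) hn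
    have h2y : (2 : ℤ) ∣ y := Int.prime_two.dvd_of_dvd_pow ((Int.prime_two.dvd_or_dvd h1).resolve_left hm2)
    exact h2u (hxy.isUnit_of_dvd' h2x h2y)
  have hy : Odd y := by
    rw [← Int.not_even_iff_odd, even_iff_two_dvd]
    intro h2y
    have h1 : (2 : ℤ) ∣ x ^ 2 := by
      have e : x ^ 2 = n + m * y ^ 2 := by linear_combination hrep
      rw [e]; exact dvd_add hn (dvd_mul_of_dvd_right (dvd_pow h2y two_ne_zero) _)
    exact h2u (hxy.isUnit_of_dvd' (Int.prime_two.dvd_of_dvd_pow h1) h2y)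
  refine ⟨hx, hy, ?_⟩
  obtain ⟨a, ha⟩ := eight_dvd_sq_sub_one hx
  obtain ⟨b, hb⟩ := eight_dvd_sq_sub_one hy
  exact ⟨a - m * b, by linear_combination -hrep + ha - m * hb⟩

/-- **Exact 2-adic valuation of an even primitive norm**: `2^e ‖ n` forces `e ≥ 3` if `m ≡ 1 (mod 8)` and `e = 2` if
`m ≡ 5 (mod 8)` (PROPOSITION 2's values). -/
theorem two_adic_exponent {m n x y : ℤ} {e : ℕ} (hrep : x ^ 2 - m * y ^ 2 = n) (hxy : IsCoprime x y) (hn : 2 ∣ n)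
    (he : (2 : ℤ) ^ e ∣ n) (he' : ¬ (2 : ℤ) ^ (e + 1) ∣ n) :
    (m % 8 = 1 → 3 ≤ e) ∧ (m % 8 = 5 → e = 2) := by
  constructor
  · intro h1
    have hm : Odd m := by rw [Int.odd_iff]; omega
    obtain ⟨c, hc⟩ := (norm_two_adic hm hrep hxy hn).2.2
    have h8 : (8 : ℤ) ∣ n := Int.dvd_of_emod_eq_zero (by omega)
    by_contra hlt
    exact he' ((pow_dvd_pow 2 (show e + 1 ≤ 3 by omega)).trans (by norm_num; exact h8))
  · intro h5
    have hm : Odd m := by rw [Int.odd_iff]; omega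
    obtain ⟨c, hc⟩ := (norm_two_adic hm hrep hxy hn).2.2
    have h4 : (4 : ℤ) ∣ n := Int.dvd_of_emod_eq_zero (by omega)
    have h8 : ¬ (8 : ℤ) ∣ n := by
      rintro ⟨d, hd⟩; omega
    have hle : e ≤ 2 := by
      by_contra hlt
      exact h8 ((pow_dvd_pow 2 (show 3 ≤ e by omega)).trans he |> fun h => by norm_num at h; exact h)
    have hge : 2 ≤ e := by
      by_contra hlt
      exact he' ((pow_dvd_pow 2 (show e + 1 ≤ 2 by omega)).trans (by norm_num; exact h4))
    omega

/-- **The 2-adic adjustment of §3 STEP 1** (`e = e' + 3 ≥ 3`): for odd `A₀`, odd `M'` and `2^{e+1} ∣ A₀² − m`, the shifted root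
`A = A₀ + 2^{e−1}·M'` has `2^e ∣ A² − m` and `2^{e+1} ∤ A² − m` (since `A² − m = (A₀² − m) + 2^e·A₀M' + 2^{2e−2}·M'²`). -/
theorem adjust_not_dvd {m A₀ M' : ℤ} {e' : ℕ} (hA : Odd A₀) (hM : Odd M') (h0 : (2 : ℤ) ^ (e' + 4) ∣ A₀ ^ 2 - m) :
    (2 : ℤ) ^ (e' + 3) ∣ (A₀ + 2 ^ (e' + 2) * M') ^ 2 - m ∧
      ¬ (2 : ℤ) ^ (e' + 4) ∣ (A₀ + 2 ^ (e' + 2) * M') ^ 2 - m := by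
  have expand : (A₀ + 2 ^ (e' + 2) * M') ^ 2 - m =
      (A₀ ^ 2 - m) + 2 ^ (e' + 3) * (A₀ * M') + 2 ^ (e' + 4) * (2 ^ e' * M' ^ 2) := by ring
  obtain ⟨q, hq⟩ := h0
  rw [expand, hq]
  constructor
  · refine dvd_add (dvd_add (Dvd.intro (2 * q) (by ring)) (Dvd.intro _ rfl)) (Dvd.intro (2 * (2 ^ e' * M' ^ 2)) (by ring))
  · rintro ⟨r, hr⟩
    have h2 : (2 : ℤ) ^ (e' + 3) * (A₀ * M') = 2 ^ (e' + 3) * (2 * (r - q - 2 ^ e' * M' ^ 2)) := by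
      linear_combination hr
    have h3 := mul_left_cancel₀ (pow_ne_zero _ (two_ne_zero : (2 : ℤ) ≠ 0)) h2
    obtain ⟨t, ht⟩ := hA.mul hM
    rw [ht] at h3
    generalize 2 ^ e' * M' ^ 2 = Q at h3
    omega

/-! ## THEOREM A′ «⇐» -/

/-- **THEOREM A′, sufficiency, for `m ≡ 1 (mod 4)`** (LINE-LAW-THEOREMS-B §3; `m < 0` squarefree, one class per genus for `4m`):
if every listed quotient `n` is a primitive norm `x² − m y² > 0` and all EVEN quotients are exactly divisible by the same power `2^e`
(PROPOSITION 2's 2-ADIC RULE — nothing is asked of `e`; `two_adic_exponent` shows `e ≥ 3` resp. `e = 2` is forced), then ONE integer `A`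
serves every quotient: each `n` is the norm of a primitive `z ∈ ℤ√m` dividing `A − √m`.  With THEOREM CF⁶ (by value) this is «the line
is reached at `T`».  STEP 1 = `LineLawCommonRoot.exists_common_root` (324) + `adjust_not_dvd`; STEPS 2–4 = #B22
`capture_one_mod_four_of_parity` per weight. -/
theorem lineLaw_sufficiency_one_mod_four {m : ℤ} (hm : m < 0) (hm4 : m % 4 = 1) (hsq : Squarefree m)
    (hh : BinaryQuadraticForm.classNumber (4 * m) = 2 ^ (assignedCharCount (4 * m) - 1))
    (ns : List ℕ) (hrep : ∀ n ∈ ns, 0 < n ∧ ∃ x y : ℤ, x ^ 2 - m * y ^ 2 = n ∧ IsCoprime x y)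
    (e : ℕ) (h2 : ∀ n ∈ ns, 2 ∣ n → 2 ^ e ∣ n ∧ ¬ 2 ^ (e + 1) ∣ n) :
    ∃ A : ℤ, ∀ n ∈ ns, ∃ z : ℤ√m, z.norm = n ∧ z ∣ (⟨A, -1⟩ : ℤ√m) ∧ IsCoprime z.re z.im := by
  -- STEP 1a: a common root `A₀` (324)
  have hroot : ∀ n ∈ ns, 0 < n ∧ ∃ A : ℤ, (n : ℤ) ∣ A ^ 2 - m := by
    intro n hn
    obtain ⟨hpos, x, y, hxyn, hxy⟩ := hrep n hn
    obtain ⟨A, hA⟩ := exists_root_of_primitive_rep m hxy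
    exact ⟨hpos, A, by rwa [hxyn] at hA⟩
  obtain ⟨A₀, hA₀⟩ := exists_common_root ns hroot
  -- the capture (#B22) at any root `A` at which no even quotient has an even cofactor
  have finish : ∀ A : ℤ, (∀ n ∈ ns, (n : ℤ) ∣ A ^ 2 - m) → (∀ n ∈ ns, 2 ∣ n → ¬ (2 : ℤ) ^ (e + 1) ∣ A ^ 2 - m) →
      ∀ n ∈ ns, ∃ z : ℤ√m, z.norm = n ∧ z ∣ (⟨A, -1⟩ : ℤ√m) ∧ IsCoprime z.re z.im := by
    intro A hA hodd n hn
    obtain ⟨hpos, x, y, hxyn, hxy⟩ := hrep n hn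
    obtain ⟨k, hk⟩ := hA n hn
    have hk' : A ^ 2 - n * k = m := by linear_combination hk
    refine capture_one_mod_four_of_parity hm hm4 hsq hh (by exact_mod_cast hpos) hk' hxyn hxy ?_
    by_cases hn2 : 2 ∣ n
    · right
      rw [← Int.not_even_iff_odd, even_iff_two_dvd]
      rintro ⟨k', rfl⟩
      obtain ⟨n', hn'⟩ := (h2 n hn hn2).1
      refine hodd n hn hn2 ⟨n' * k', ?_⟩
      rw [hk, hn']; push_cast; ring
    · left
      exact (Int.odd_coe_nat n).2 (Nat.odd_iff.2 (by omega))
  by_cases hev : ∃ n ∈ ns, 2 ∣ n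
  swap
  · exact ⟨A₀, finish A₀ hA₀ (fun n hn hn2 => (hev ⟨n, hn, hn2⟩).elim)⟩
  obtain ⟨n₀, hn₀, hn₀2⟩ := hev
  obtain ⟨-, x₀, y₀, hrep₀, hxy₀⟩ := hrep n₀ hn₀
  obtain ⟨he₀, he₀'⟩ := h2 n₀ hn₀ hn₀2
  have hc2 : (2 : ℤ) ∣ (n₀ : ℤ) := by exact_mod_cast hn₀2
  have hce : (2 : ℤ) ^ e ∣ (n₀ : ℤ) := by exact_mod_cast he₀
  have hce' : ¬ (2 : ℤ) ^ (e + 1) ∣ (n₀ : ℤ) := fun h => he₀' (by exact_mod_cast h)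
  obtain ⟨h1, h5⟩ := two_adic_exponent hrep₀ hxy₀ hc2 hce hce'
  -- `A₀` is odd
  have hA₀odd : Odd A₀ := by
    rw [← Int.not_even_iff_odd, even_iff_two_dvd]
    intro h2A
    have h := dvd_sub (dvd_pow h2A two_ne_zero) (hc2.trans (hA₀ n₀ hn₀))
    rw [sub_sub_cancel] at h
    omega
  have hm8 : m % 8 = 1 ∨ m % 8 = 5 := by omega
  rcases hm8 with h1' | h5'
  · -- `m ≡ 1 (mod 8)`: `e ≥ 3`; adjust `A₀` if `2^{e+1} ∣ A₀² − m`
    obtain ⟨e', rfl⟩ : ∃ e', e = e' + 3 := ⟨e - 3, by have := h1 h1'; omega⟩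
    by_cases hdiv : (2 : ℤ) ^ (e' + 3 + 1) ∣ A₀ ^ 2 - m
    swap
    · exact ⟨A₀, finish A₀ hA₀ (fun n _ _ => hdiv)⟩
    -- the odd part `M'` of `∏ n`
    have hM0 : ns.prod ≠ 0 := List.prod_ne_zero (fun h => (lt_irrefl 0) (hrep 0 h).1)
    set M' : ℕ := ordCompl[2] ns.prod with hM'def
    have hM'odd : ¬ 2 ∣ M' := Nat.not_dvd_ordCompl Nat.prime_two hM0
    have hsplit : ordProj[2] ns.prod * M' = ns.prod := Nat.ordProj_mul_ordCompl_eq_self _ _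
    have hdvdM' : ∀ d : ℕ, ¬ 2 ∣ d → d ∣ ns.prod → d ∣ M' := by
      intro d hd hdM
      have hcop : Nat.Coprime d (ordProj[2] ns.prod) :=
        (Nat.coprime_two_right.2 (Nat.odd_iff.2 (by omega))).pow_right _
      rw [← hsplit, mul_comm] at hdM
      exact hcop.dvd_of_dvd_mul_right hdM
    have hM'oddZ : Odd (M' : ℤ) := (Int.odd_coe_nat M').2 (Nat.odd_iff.2 (by omega))
    obtain ⟨hA2, hA2'⟩ := adjust_not_dvd (m := m) hA₀odd hM'oddZ hdiv
    set A : ℤ := A₀ + 2 ^ (e' + 2) * (M' : ℤ) with hAdef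
    have hAA₀ : (M' : ℤ) ∣ A - A₀ := ⟨2 ^ (e' + 2), by rw [hAdef]; ring⟩
    refine ⟨A, finish A (fun n hn => ?_) (fun n _ _ => hA2')⟩
    have hnM : n ∣ ns.prod := List.dvd_prod hn
    by_cases hn2 : 2 ∣ n
    · obtain ⟨n', hn'⟩ := (h2 n hn hn2).1
      have hn'odd : ¬ 2 ∣ n' := fun h =>
        (h2 n hn hn2).2 (by rw [hn', pow_succ]; exact mul_dvd_mul_left _ h)
      have hn'M' : n' ∣ M' := hdvdM' n' hn'odd ((Dvd.intro_left _ hn'.symm).trans hnM)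
      have hodd_part : (n' : ℤ) ∣ A ^ 2 - m :=
        root_of_congr ((Int.natCast_dvd_natCast.2 hn'M').trans hAA₀)
          ((Int.natCast_dvd_natCast.2 (Dvd.intro_left _ hn'.symm)).trans (hA₀ n hn))
      have hcop : IsCoprime ((2 : ℤ) ^ (e' + 3)) (n' : ℤ) := by
        have h : Nat.Coprime (2 ^ (e' + 3)) n' := (Nat.coprime_two_left.2 (Nat.odd_iff.2 (by omega))).pow_left _
        exact_mod_cast Nat.isCoprime_iff_coprime.2 h
      rw [hn']; push_cast
      exact hcop.mul_dvd hA2 hodd_part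
    · exact root_of_congr ((Int.natCast_dvd_natCast.2 (hdvdM' n hn2 hnM)).trans hAA₀) (hA₀ n hn)
  · -- `m ≡ 5 (mod 8)`: `e = 2` and `v₂(A₀² − m) = 2` for the odd `A₀`
    have he2 := h5 h5'
    subst he2
    refine ⟨A₀, finish A₀ hA₀ (fun n _ _ => ?_)⟩
    obtain ⟨c, hc⟩ := eight_dvd_sq_sub_one hA₀odd
    rintro ⟨d, hd⟩
    norm_num at hd
    omega

/-- **Instance in numbers (`m = −7`, `h(−28) = 1 = 2^{μ−1}`)**: the even quotients `8 = 1 + 7`, `56 = 49 + 7`, `88 = 81 + 7` (all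
`2³‖`, `e = 3`) share the root `A = 343` with ODD cofactors `14707, 2101, 1337` — the situation the theorem produces (a root with an
even cofactor, e.g. `A = 35`: `35² + 7 = 1232 = 8·154`, is repaired by the shift of `adjust_not_dvd`); and the capture of `8` there:
`(1 + √−7)(42 − 43√−7) = 343 − √−7`. -/
example : (343 : ℤ) ^ 2 - (-7) = 8 * 14707 ∧ (343 : ℤ) ^ 2 - (-7) = 56 * 2101 ∧ (343 : ℤ) ^ 2 - (-7) = 88 * 1337 ∧
    (35 : ℤ) ^ 2 - (-7) = 8 * 154 ∧ (⟨1, 1⟩ : ℤ√(-7)) * ⟨42, -43⟩ = ⟨343, -1⟩ := by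
  refine ⟨by norm_num, by norm_num, by norm_num, by norm_num, by ext <;> simp⟩

end Summit.Ventures.HSemireg.LineLawOneModFourSufficiency
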